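import Summits.HubbardSuperconductivity.HubbardLadder.ObservableWindow
import Literature.MathematicalPhysics.QuantumLattice.HeisenbergGroundStateSymmetry
import HarnessLib

/-!
# R2 soundness — singlet-sector (Lieb–Mattis) annihilator rows for Heisenberg ground-state certificates (part 1: abstract rows)

Cell `pub-hubbard`, seat R2 (generation 3). HONEST FRAMING: ladder R1–R4 with certified numbers;
no claim on H/H₀. Part 1 of 2 (the 400-line directory limit): this file holds the abstract device and
the graph-generic Heisenberg theorems; `ObservableWindowSingletTorus` discharges the graph hypotheses
for the even torus and states the `m_s²(L)` rows. Together they add ONE device to the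
window-certificate soundness theorems of `ObservableWindowAbstract` / `ObservableWindowVector` /
`ObservableWindow`:

* **Annihilator null terms (§1).** If an operator `Z` kills the ground space of `A`
  (`∀ v ∈ groundSpace A, Z v = 0`), then `ω₀(Y Z) = 0` and `ω₀(Zᴴ Y) = 0` for the tracial
  ground state `ω₀ = groundStateFunctional A` (`groundStateFunctional_mul_eq_zero_of_groundSpace`,
  `groundStateFunctional_mul_eq_zero_of_groundSpace'`), so such terms may be added to the null part
  of a window certificate (`re_groundStateFunctional_ge_of_windowCertificate_ann` and its `le` /
  residual forms). For an energy EIGENVECTOR state the corresponding statement is already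
  `re_vectorState_ge_of_windowCertificate` (hypotheses `hZ`, `hZ'`).
* **The Lieb–Mattis singlet rows (§2).** For the spin-`n/2` Heisenberg antiferromagnet (`J > 0`) on
  a connected graph bipartite in `A`, `Aᶜ` with `|A| = |Aᶜ|`, every ground-state vector is a
  total-spin singlet (tree theorem `marshall_lieb_mattis_spin_holds`:
  `(𝐒_tot)² ψ = S₀(S₀+1) ψ`, `S₀ = 0`), hence `S^α_tot ψ = 0` for every `α`
  (`totalSpin_mulVec_eq_zero_of_mem_groundSpace`; the step `(𝐒_tot)² ψ = 0 ⇒ S^α_tot ψ = 0` is the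
  sum-of-squares lemma `mulVec_eq_zero_of_sum_hermitianSq_mulVec_eq_zero`). Consequently the rows
  `ω₀(Y · S^α_tot) = 0`, `ω₀(S^α_tot · Y) = 0` are SOUND in every ground-state certificate of such a
  model (`re_groundStateFunctional_ge/le_of_windowCertificate_singlet`, graph hypotheses explicit as
  everywhere in `Literature/…/LiebMattis*`), including a certified ground-ENERGY lower bound
  (`groundEnergy_ge_of_certificate_singlet`: the singlet-sector relaxation bounds `E₀` itself).

Why this matters for R2 (design note `pub-hubbard-r2/SINGLET-ROWS.md`): the relaxations built by
`certsdp 0.4.1` for the Heisenberg tori impose NO total-spin sector (only `U(1)` charge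
superselection of the word basis and lattice-symmetry identification); the singlet rows are
ground-state specific linear constraints that are not consequences of symmetry averaging (they
imply `ω(𝐒_tot²) = 0`, which no invariant state other than a singlet satisfies), and they are exact
rationals in the spin basis — so they can only tighten a Heisenberg ground-state bracket, at zero
cost in the certificate format (`energy_upper` row + PSD Gram + null rows). Prior art: the
"spin-singlet projection" constraints of variational 2-RDM theory (Gidofalvi–Mazziotti, Phys. Rev.
A 72, 052505 (2005); Verstichel, arXiv:1203.5659 §"Imposing the spin constraints for 𝒮 = 0")
impose `S^α ψ = 0` for an ASSUMED target spin; here the singlet property of the ground state is a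
THEOREM (Lieb–Mattis), which is what makes the rows admissible in a certified lower bound.

No certificate is contained here; these are soundness edges. References: Lieb–Mattis, J. Math.
Phys. 3 (1962) 749, Thm 2 [cite: LiebMattis1962, Theorem 2]; Tasaki (2020) Thm 2.3
[cite: Tasaki2020]; Wang et al. (2024) §3 eq. (4) (energy-window bootstrap) [cite: WangEtAl2024].
-/


namespace Summit.HubbardSuperconductivity.HubbardLadder

open Matrix Finset Filter Literature.Probability.LatticeModels
  Literature.MathematicalPhysics.QuantumLattice
  Literature.MathematicalPhysics.QuantumManyBody.StateRelaxation
open scoped ComplexOrder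

noncomputable section

/-! ## §1 Annihilators of the ground space give null rows of the tracial ground state -/

section MatrixInstances

variable {n : Type*} [Fintype n] [DecidableEq n]
variable {m : Type*} [Fintype m] [DecidableEq m]

/-- If `Z` kills the ground space of `A` then `Z P₀ = 0` (`P₀ = groundProj A` maps into the ground
space). [folklore] -/
theorem mul_groundProj_eq_zero_of_groundSpace {A Z : Matrix n n ℂ}
    (hZ : ∀ v ∈ A.groundSpace, Z *ᵥ v = 0) : Z * A.groundProj = 0 := by
  rw [ext_iff_mulVec]
  intro w
  rw [← mulVec_mulVec, zero_mulVec]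
  exact hZ _ (Matrix.groundProj_mulVec_mem A w)

/-- If `Zᴴ` kills the ground space of `A` then `P₀ Z = 0` (`P₀` is Hermitian). [folklore] -/
theorem groundProj_mul_eq_zero_of_groundSpace {A Z : Matrix n n ℂ}
    (hZ : ∀ v ∈ A.groundSpace, Zᴴ *ᵥ v = 0) : A.groundProj * Z = 0 := by
  have h := congrArg conjTranspose (mul_groundProj_eq_zero_of_groundSpace hZ)
  rwa [conjTranspose_mul, conjTranspose_conjTranspose, (Matrix.groundProj_isHermitian A).eq,
    conjTranspose_zero] at h

/-- **Right annihilator row**: `ω₀(Y Z) = 0` whenever `Z` kills the ground space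
(`tr (P₀ Y Z) = tr (Z P₀ Y) = 0`). [folklore] -/
theorem groundStateFunctional_mul_eq_zero_of_groundSpace (A Y : Matrix n n ℂ) {Z : Matrix n n ℂ}
    (hZ : ∀ v ∈ A.groundSpace, Z *ᵥ v = 0) : A.groundStateFunctional (Y * Z) = 0 := by
  rw [Matrix.groundStateFunctional_apply, ← mul_assoc, trace_mul_cycle,
    mul_groundProj_eq_zero_of_groundSpace hZ, zero_mul, trace_zero, mul_zero]

/-- **Left annihilator row**: `ω₀(Z Y) = 0` whenever `Zᴴ` kills the ground space. [folklore] -/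
theorem groundStateFunctional_mul_eq_zero_of_groundSpace' (A Y : Matrix n n ℂ) {Z : Matrix n n ℂ}
    (hZ : ∀ v ∈ A.groundSpace, Zᴴ *ᵥ v = 0) : A.groundStateFunctional (Z * Y) = 0 := by
  rw [Matrix.groundStateFunctional_apply, ← mul_assoc, groundProj_mul_eq_zero_of_groundSpace hZ,
    zero_mul, trace_zero, mul_zero]

/-- The combined null part of an R2 certificate for the tracial ground state — commutators with `A`,
symmetry defects of unitaries commuting with `A`, and annihilator rows `Y₁ₗ Zₗ + Z'ₗ Y₂ₗ` with
`Zₗ`, `Z'ₗᴴ` killing the ground space — has zero expectation. [folklore] -/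
theorem groundStateFunctional_nullPart_ann_eq_zero {A : Matrix n n ℂ} (hA : A.IsHermitian)
    {κ : Type*} (s : Finset κ) (X : κ → Matrix n n ℂ)
    {ι : Type*} (t : Finset ι) (U Y : ι → Matrix n n ℂ)
    (hU : ∀ l ∈ t, U l * A = A * U l) (hUU : ∀ l ∈ t, (U l)ᴴ * U l = 1)
    {ι' : Type*} (t' : Finset ι') (Y₁ Z Z' Y₂ : ι' → Matrix n n ℂ)
    (hZ : ∀ l ∈ t', ∀ v ∈ A.groundSpace, Z l *ᵥ v = 0)
    (hZ' : ∀ l ∈ t', ∀ v ∈ A.groundSpace, (Z' l)ᴴ *ᵥ v = 0) :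
    A.groundStateFunctional
      (∑ k ∈ s, (A * X k - X k * A) + ∑ l ∈ t, (U l * Y l * (U l)ᴴ - Y l) +
        ∑ l ∈ t', (Y₁ l * Z l + Z' l * Y₂ l)) = 0 := by
  rw [map_add, map_add, map_sum, map_sum, map_sum]
  have h1 : ∀ k ∈ s, A.groundStateFunctional (A * X k - X k * A) = 0 := fun k _ => by
    rw [map_sub, Matrix.groundStateFunctional_hamiltonian_mul hA,
      Matrix.groundStateFunctional_mul_hamiltonian, sub_self]
  have h2 : ∀ l ∈ t, A.groundStateFunctional (U l * Y l * (U l)ᴴ - Y l) = 0 := fun l hl => by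
    rw [map_sub, Matrix.groundStateFunctional_conj_of_commute hA (hU l hl) (hUU l hl), sub_self]
  have h3 : ∀ l ∈ t', A.groundStateFunctional (Y₁ l * Z l + Z' l * Y₂ l) = 0 := fun l hl => by
    rw [map_add, groundStateFunctional_mul_eq_zero_of_groundSpace A _ (hZ l hl),
      groundStateFunctional_mul_eq_zero_of_groundSpace' A _ (hZ' l hl), add_zero]
  rw [Finset.sum_eq_zero h1, Finset.sum_eq_zero h2, Finset.sum_eq_zero h3, add_zero, add_zero]

/-- **Window certificate with annihilator rows ⇒ ground-state observable lower bound (tracial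
state).** As `re_groundStateFunctional_ge_of_windowCertificate`, with a third null family
`Σₗ (Y₁ₗ Zₗ + Z'ₗ Y₂ₗ)`, `Zₗ`, `Z'ₗᴴ` killing the ground space of `A`:
`V - c·1 = Σ Λᵢⱼ Oᵢᴴ Oⱼ + (commutators + symmetry defects + annihilator rows) + μ·(E_up·1 - A)`,
`Λ ⪰ 0`, `μ ≥ 0`, `E₀(A) ≤ E_up` ⇒ `c ≤ Re ω₀(V)`. [cite: WangEtAl2024, §3 eq. (4)] -/
theorem re_groundStateFunctional_ge_of_windowCertificate_ann [Nonempty n] {A : Matrix n n ℂ}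
    (hA : A.IsHermitian) {Λ : Matrix m m ℂ} (hΛ : Λ.PosSemidef) (O : m → Matrix n n ℂ)
    {κ : Type*} (s : Finset κ) (X : κ → Matrix n n ℂ)
    {ι : Type*} (t : Finset ι) (U Y : ι → Matrix n n ℂ)
    (hU : ∀ l ∈ t, U l * A = A * U l) (hUU : ∀ l ∈ t, (U l)ᴴ * U l = 1)
    {ι' : Type*} (t' : Finset ι') (Y₁ Z Z' Y₂ : ι' → Matrix n n ℂ)
    (hZ : ∀ l ∈ t', ∀ v ∈ A.groundSpace, Z l *ᵥ v = 0)
    (hZ' : ∀ l ∈ t', ∀ v ∈ A.groundSpace, (Z' l)ᴴ *ᵥ v = 0)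
    {V : Matrix n n ℂ} {Eup μ c : ℝ} (hμ : 0 ≤ μ) (hE : A.groundEnergy ≤ Eup)
    (hcert : V - (c : ℂ) • (1 : Matrix n n ℂ) =
      gramForm Λ O +
        (∑ k ∈ s, (A * X k - X k * A) + ∑ l ∈ t, (U l * Y l * (U l)ᴴ - Y l) +
          ∑ l ∈ t', (Y₁ l * Z l + Z' l * Y₂ l)) +
        (μ : ℂ) • ((Eup : ℂ) • (1 : Matrix n n ℂ) - A)) :
    c ≤ (A.groundStateFunctional V).re := by
  set ω := A.groundStateFunctional with hω
  have hpos : ∀ a : Matrix n n ℂ, 0 ≤ ω (star a * a) := fun a => by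
    rw [hω, Matrix.star_eq_conjTranspose]; exact Matrix.groundStateFunctional_nonneg A a
  have hone : ω 1 = 1 := Matrix.groundStateFunctional_one hA
  have hnull := groundStateFunctional_nullPart_ann_eq_zero hA s X t U Y hU hUU t' Y₁ Z Z' Y₂ hZ hZ'
  have hE' : (ω A).re ≤ Eup := by
    rw [hω, Matrix.groundStateFunctional_hamiltonian hA, Complex.ofReal_re]; exact hE
  exact le_re_map_of_windowCertificate ω hpos hone hΛ O hnull hμ hE' hcert

/-- Upper-bound reading with annihilator rows: a certificate for `-V` gives `Re ω₀(V) ≤ -c`.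
[cite: WangEtAl2024, §3 eq. (4)] -/
theorem re_groundStateFunctional_le_of_windowCertificate_ann [Nonempty n] {A : Matrix n n ℂ}
    (hA : A.IsHermitian) {Λ : Matrix m m ℂ} (hΛ : Λ.PosSemidef) (O : m → Matrix n n ℂ)
    {κ : Type*} (s : Finset κ) (X : κ → Matrix n n ℂ)
    {ι : Type*} (t : Finset ι) (U Y : ι → Matrix n n ℂ)
    (hU : ∀ l ∈ t, U l * A = A * U l) (hUU : ∀ l ∈ t, (U l)ᴴ * U l = 1)
    {ι' : Type*} (t' : Finset ι') (Y₁ Z Z' Y₂ : ι' → Matrix n n ℂ)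
    (hZ : ∀ l ∈ t', ∀ v ∈ A.groundSpace, Z l *ᵥ v = 0)
    (hZ' : ∀ l ∈ t', ∀ v ∈ A.groundSpace, (Z' l)ᴴ *ᵥ v = 0)
    {V : Matrix n n ℂ} {Eup μ c : ℝ} (hμ : 0 ≤ μ) (hE : A.groundEnergy ≤ Eup)
    (hcert : -V - (c : ℂ) • (1 : Matrix n n ℂ) =
      gramForm Λ O +
        (∑ k ∈ s, (A * X k - X k * A) + ∑ l ∈ t, (U l * Y l * (U l)ᴴ - Y l) +
          ∑ l ∈ t', (Y₁ l * Z l + Z' l * Y₂ l)) +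
        (μ : ℂ) • ((Eup : ℂ) • (1 : Matrix n n ℂ) - A)) :
    (A.groundStateFunctional V).re ≤ -c := by
  have h := re_groundStateFunctional_ge_of_windowCertificate_ann hA hΛ O s X t U Y hU hUU t' Y₁ Z
    Z' Y₂ hZ hZ' hμ hE hcert
  rw [map_neg, Complex.neg_re] at h
  linarith

/-- **Rounded window certificate with annihilator rows (tracial state)**: an explicit residual `r`
with `-ε ≤ Re ω₀(r)` gives `c - ε ≤ Re ω₀(V)`. [cite: KullEtAl2024, §5.3] -/
theorem re_groundStateFunctional_ge_of_windowCertificate_ann_residual [Nonempty n]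
    {A : Matrix n n ℂ} (hA : A.IsHermitian) {Λ : Matrix m m ℂ} (hΛ : Λ.PosSemidef)
    (O : m → Matrix n n ℂ)
    {κ : Type*} (s : Finset κ) (X : κ → Matrix n n ℂ)
    {ι : Type*} (t : Finset ι) (U Y : ι → Matrix n n ℂ)
    (hU : ∀ l ∈ t, U l * A = A * U l) (hUU : ∀ l ∈ t, (U l)ᴴ * U l = 1)
    {ι' : Type*} (t' : Finset ι') (Y₁ Z Z' Y₂ : ι' → Matrix n n ℂ)
    (hZ : ∀ l ∈ t', ∀ v ∈ A.groundSpace, Z l *ᵥ v = 0)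
    (hZ' : ∀ l ∈ t', ∀ v ∈ A.groundSpace, (Z' l)ᴴ *ᵥ v = 0)
    {V r : Matrix n n ℂ} {ε : ℝ} (hr : -ε ≤ (A.groundStateFunctional r).re)
    {Eup μ c : ℝ} (hμ : 0 ≤ μ) (hE : A.groundEnergy ≤ Eup)
    (hcert : V - (c : ℂ) • (1 : Matrix n n ℂ) =
      gramForm Λ O +
        (∑ k ∈ s, (A * X k - X k * A) + ∑ l ∈ t, (U l * Y l * (U l)ᴴ - Y l) +
          ∑ l ∈ t', (Y₁ l * Z l + Z' l * Y₂ l)) +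
        (μ : ℂ) • ((Eup : ℂ) • (1 : Matrix n n ℂ) - A) + r) :
    c - ε ≤ (A.groundStateFunctional V).re := by
  set ω := A.groundStateFunctional with hω
  have hpos : ∀ a : Matrix n n ℂ, 0 ≤ ω (star a * a) := fun a => by
    rw [hω, Matrix.star_eq_conjTranspose]; exact Matrix.groundStateFunctional_nonneg A a
  have hone : ω 1 = 1 := Matrix.groundStateFunctional_one hA
  have hnull := groundStateFunctional_nullPart_ann_eq_zero hA s X t U Y hU hUU t' Y₁ Z Z' Y₂ hZ hZ'
  have hE' : (ω A).re ≤ Eup := by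
    rw [hω, Matrix.groundStateFunctional_hamiltonian hA, Complex.ofReal_re]; exact hE
  exact le_re_map_of_windowCertificate_residual ω hpos hone hΛ O hnull hr hμ hE' hcert

omit [DecidableEq n] in
/-- **Sum of Hermitian squares.** If `(Σ_{a∈s} S_a S_a) ψ = 0` with every `S_a` Hermitian, then
`S_a ψ = 0` for each `a ∈ s` (`0 = ⟨ψ, Σ S_a² ψ⟩ = Σ ‖S_a ψ‖²`). [folklore] -/
theorem mulVec_eq_zero_of_sum_hermitianSq_mulVec_eq_zero {ι : Type*} (s : Finset ι)
    (S : ι → Matrix n n ℂ) (hS : ∀ a ∈ s, (S a).IsHermitian) {ψ : n → ℂ}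
    (h : (∑ a ∈ s, S a * S a) *ᵥ ψ = 0) : ∀ a ∈ s, S a *ᵥ ψ = 0 := by
  have hq : ∀ a ∈ s, star ψ ⬝ᵥ ((S a * S a) *ᵥ ψ) = star (S a *ᵥ ψ) ⬝ᵥ (S a *ᵥ ψ) := by
    intro a ha
    rw [star_mulVec, (hS a ha).eq, ← dotProduct_mulVec, mulVec_mulVec]
  have hsum : star ψ ⬝ᵥ ((∑ a ∈ s, S a * S a) *ᵥ ψ) =
      ∑ a ∈ s, star (S a *ᵥ ψ) ⬝ᵥ (S a *ᵥ ψ) := by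
    rw [sum_mulVec, dotProduct_sum]
    exact Finset.sum_congr rfl hq
  rw [h, dotProduct_zero] at hsum
  have hnn : ∀ a ∈ s, 0 ≤ star (S a *ᵥ ψ) ⬝ᵥ (S a *ᵥ ψ) := fun a _ =>
    dotProduct_star_self_nonneg _
  have hz := (Finset.sum_eq_zero_iff_of_nonneg hnn).1 hsum.symm
  intro a ha
  exact dotProduct_star_self_eq_zero.1 (hz a ha)

end MatrixInstances

/-! ## §2 The Lieb–Mattis singlet rows for the Heisenberg antiferromagnet -/

section Heisenberg

variable {Λ : Type*} [Fintype Λ] [DecidableEq Λ]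
variable {m : Type*} [Fintype m] [DecidableEq m]

/-- `(𝐒_tot)² ψ = 0 ⇒ S^α_tot ψ = 0` for each component (`(𝐒_tot)² = Σ_α (S^α_tot)²` with
Hermitian `S^α_tot`). [folklore] -/
theorem totalSpin_mulVec_eq_zero_of_totalSpinSq_mulVec_eq_zero (n : ℕ)
    {ψ : TensorIndex Λ (n + 1) → ℂ} (h : totalSpinSq (Λ := Λ) n *ᵥ ψ = 0) (α : Fin 3) :
    totalSpin (Λ := Λ) n α *ᵥ ψ = 0 :=
  mulVec_eq_zero_of_sum_hermitianSq_mulVec_eq_zero Finset.univ (fun a => totalSpin (Λ := Λ) n a)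
    (fun a _ => totalSpin_isHermitian n a) (by simpa only [totalSpinSq] using h) α (Finset.mem_univ α)

variable (n : ℕ) (G : SimpleGraph Λ) [DecidableRel G.Adj] (A : Finset Λ) (J : ℝ)

/-- **Singlet ground states (Lieb–Mattis) ⇒ `S^α_tot` annihilates the ground space.** For the
spin-`n/2` Heisenberg antiferromagnet (`J > 0`) on a connected graph bipartite in `A`, `Aᶜ` with
`|Aᶜ| = |A|`: every `ψ` in the ground space satisfies `S^α_tot ψ = 0`, `α = 1,2,3`
(from `marshall_lieb_mattis_spin_holds`: `(𝐒_tot)² ψ = S₀(S₀+1) ψ` with `S₀ = 0`).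
[cite: LiebMattis1962, Theorem 2] -/
theorem totalSpin_mulVec_eq_zero_of_mem_groundSpace (hG : G.Connected)
    (hA : G.IsBipartiteWith (A : Set Λ) (↑A)ᶜ) (hJ : 0 < J) (hcard : Aᶜ.card = A.card)
    {ψ : TensorIndex Λ (n + 1) → ℂ} (hψ : ψ ∈ (heisenbergHamiltonian n G J).groundSpace)
    (α : Fin 3) : totalSpin (Λ := Λ) n α *ᵥ ψ = 0 := by
  by_cases hψ0 : ψ = 0
  · rw [hψ0, mulVec_zero]
  have hGS : (heisenbergHamiltonian n G J).IsGroundStateVector ψ :=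
    (Matrix.isGroundStateVector_iff _ _).2 ⟨hψ0, hψ⟩
  obtain ⟨hspin, -⟩ := marshall_lieb_mattis_spin_holds n G A J hG hA hJ
  have hS0 : liebMattisSpin n A = 0 := by simp [liebMattisSpin, hcard]
  have h := hspin ψ hGS
  simp only [hS0, zero_mul, Complex.ofReal_zero, zero_smul] at h
  exact totalSpin_mulVec_eq_zero_of_totalSpinSq_mulVec_eq_zero n h α

/-- The adjoint form: `(S^α_tot)ᴴ ψ = 0` on the ground space (the spins are Hermitian).
[cite: LiebMattis1962, Theorem 2] -/
theorem totalSpin_conjTranspose_mulVec_eq_zero_of_mem_groundSpace (hG : G.Connected)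
    (hA : G.IsBipartiteWith (A : Set Λ) (↑A)ᶜ) (hJ : 0 < J) (hcard : Aᶜ.card = A.card)
    {ψ : TensorIndex Λ (n + 1) → ℂ} (hψ : ψ ∈ (heisenbergHamiltonian n G J).groundSpace)
    (α : Fin 3) : (totalSpin (Λ := Λ) n α)ᴴ *ᵥ ψ = 0 := by
  rw [(totalSpin_isHermitian n α).eq]
  exact totalSpin_mulVec_eq_zero_of_mem_groundSpace n G A J hG hA hJ hcard hψ α

/-- **Singlet rows, right form**: `ω₀(Y S^α_tot) = 0` in the tracial ground state of the balanced
bipartite Heisenberg antiferromagnet, for every operator `Y`. [cite: LiebMattis1962, Theorem 2] -/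
theorem groundStateFunctional_mul_totalSpin (hG : G.Connected)
    (hA : G.IsBipartiteWith (A : Set Λ) (↑A)ᶜ) (hJ : 0 < J) (hcard : Aᶜ.card = A.card)
    (Y : Op Λ (n + 1)) (α : Fin 3) :
    (heisenbergHamiltonian n G J).groundStateFunctional (Y * totalSpin n α) = 0 :=
  groundStateFunctional_mul_eq_zero_of_groundSpace _ Y
    (fun _ hv => totalSpin_mulVec_eq_zero_of_mem_groundSpace n G A J hG hA hJ hcard hv α)

/-- **Singlet rows, left form**: `ω₀(S^α_tot Y) = 0`. [cite: LiebMattis1962, Theorem 2] -/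
theorem groundStateFunctional_totalSpin_mul (hG : G.Connected)
    (hA : G.IsBipartiteWith (A : Set Λ) (↑A)ᶜ) (hJ : 0 < J) (hcard : Aᶜ.card = A.card)
    (Y : Op Λ (n + 1)) (α : Fin 3) :
    (heisenbergHamiltonian n G J).groundStateFunctional (totalSpin n α * Y) = 0 :=
  groundStateFunctional_mul_eq_zero_of_groundSpace' _ Y
    (fun _ hv => totalSpin_conjTranspose_mulVec_eq_zero_of_mem_groundSpace n G A J hG hA hJ hcard hv α)

/-- In particular the tracial ground state is a singlet state: `ω₀((𝐒_tot)²) = 0`.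
[cite: LiebMattis1962, Theorem 2] -/
theorem groundStateFunctional_totalSpinSq (hG : G.Connected)
    (hA : G.IsBipartiteWith (A : Set Λ) (↑A)ᶜ) (hJ : 0 < J) (hcard : Aᶜ.card = A.card) :
    (heisenbergHamiltonian n G J).groundStateFunctional (totalSpinSq n) = 0 := by
  rw [totalSpinSq, map_sum]
  exact Finset.sum_eq_zero fun α _ => groundStateFunctional_mul_totalSpin n G A J hG hA hJ hcard _ α

/-- **Window certificate with singlet rows ⇒ ground-state observable lower bound** for the balanced
bipartite Heisenberg antiferromagnet `H = heisenbergHamiltonian n G J` (`J > 0`): an identity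
`V - c·1 = Σ Λᵢⱼ Oᵢᴴ Oⱼ + (Σₖ [H, Xₖ] + Σₗ (Uₗ Yₗ Uₗᴴ - Yₗ) + Σ_q (Pq · S^{a q}_tot + S^{a' q}_tot · Qq))
+ μ·(E_up·1 - H)` with `Λ ⪰ 0`, `μ ≥ 0`, unitaries `Uₗ` commuting with `H`, `E₀(H) ≤ E_up`, proves
`c ≤ Re ω₀(V)`. [cite: WangEtAl2024, §3 eq. (4)] [cite: LiebMattis1962, Theorem 2] -/
theorem re_groundStateFunctional_ge_of_windowCertificate_singlet (hG : G.Connected)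
    (hA : G.IsBipartiteWith (A : Set Λ) (↑A)ᶜ) (hJ : 0 < J) (hcard : Aᶜ.card = A.card)
    {Λm : Matrix m m ℂ} (hΛ : Λm.PosSemidef) (O : m → Op Λ (n + 1))
    {κ : Type*} (s : Finset κ) (X : κ → Op Λ (n + 1))
    {ι : Type*} (t : Finset ι) (U Y : ι → Op Λ (n + 1))
    (hU : ∀ l ∈ t, U l * heisenbergHamiltonian n G J = heisenbergHamiltonian n G J * U l)
    (hUU : ∀ l ∈ t, (U l)ᴴ * U l = 1)
    {ι' : Type*} (t' : Finset ι') (P Q : ι' → Op Λ (n + 1)) (a a' : ι' → Fin 3)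
    {V : Op Λ (n + 1)} {Eup μ c : ℝ} (hμ : 0 ≤ μ)
    (hE : (heisenbergHamiltonian n G J).groundEnergy ≤ Eup)
    (hcert : V - (c : ℂ) • (1 : Op Λ (n + 1)) =
      gramForm Λm O +
        (∑ k ∈ s, (heisenbergHamiltonian n G J * X k - X k * heisenbergHamiltonian n G J) +
            ∑ l ∈ t, (U l * Y l * (U l)ᴴ - Y l) +
          ∑ q ∈ t', (P q * totalSpin n (a q) + totalSpin n (a' q) * Q q)) +
        (μ : ℂ) • ((Eup : ℂ) • (1 : Op Λ (n + 1)) - heisenbergHamiltonian n G J)) :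
    c ≤ ((heisenbergHamiltonian n G J).groundStateFunctional V).re :=
  haveI : Nonempty (TensorIndex Λ (n + 1)) := ⟨fun _ => 0⟩
  re_groundStateFunctional_ge_of_windowCertificate_ann (heisenbergHamiltonian_isHermitian n G J)
    hΛ O s X t U Y hU hUU t' P (fun q => totalSpin n (a q)) (fun q => totalSpin n (a' q)) Q
    (fun q _ _ hv => totalSpin_mulVec_eq_zero_of_mem_groundSpace n G A J hG hA hJ hcard hv (a q))
    (fun q _ _ hv =>
      totalSpin_conjTranspose_mulVec_eq_zero_of_mem_groundSpace n G A J hG hA hJ hcard hv (a' q))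
    hμ hE hcert

/-- Upper-bound reading with singlet rows (certificate for `-V`). [cite: WangEtAl2024, §3 eq. (4)]
[cite: LiebMattis1962, Theorem 2] -/
theorem re_groundStateFunctional_le_of_windowCertificate_singlet (hG : G.Connected)
    (hA : G.IsBipartiteWith (A : Set Λ) (↑A)ᶜ) (hJ : 0 < J) (hcard : Aᶜ.card = A.card)
    {Λm : Matrix m m ℂ} (hΛ : Λm.PosSemidef) (O : m → Op Λ (n + 1))
    {κ : Type*} (s : Finset κ) (X : κ → Op Λ (n + 1))
    {ι : Type*} (t : Finset ι) (U Y : ι → Op Λ (n + 1))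
    (hU : ∀ l ∈ t, U l * heisenbergHamiltonian n G J = heisenbergHamiltonian n G J * U l)
    (hUU : ∀ l ∈ t, (U l)ᴴ * U l = 1)
    {ι' : Type*} (t' : Finset ι') (P Q : ι' → Op Λ (n + 1)) (a a' : ι' → Fin 3)
    {V : Op Λ (n + 1)} {Eup μ c : ℝ} (hμ : 0 ≤ μ)
    (hE : (heisenbergHamiltonian n G J).groundEnergy ≤ Eup)
    (hcert : -V - (c : ℂ) • (1 : Op Λ (n + 1)) =
      gramForm Λm O +
        (∑ k ∈ s, (heisenbergHamiltonian n G J * X k - X k * heisenbergHamiltonian n G J) +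
            ∑ l ∈ t, (U l * Y l * (U l)ᴴ - Y l) +
          ∑ q ∈ t', (P q * totalSpin n (a q) + totalSpin n (a' q) * Q q)) +
        (μ : ℂ) • ((Eup : ℂ) • (1 : Op Λ (n + 1)) - heisenbergHamiltonian n G J)) :
    ((heisenbergHamiltonian n G J).groundStateFunctional V).re ≤ -c :=
  haveI : Nonempty (TensorIndex Λ (n + 1)) := ⟨fun _ => 0⟩
  re_groundStateFunctional_le_of_windowCertificate_ann (heisenbergHamiltonian_isHermitian n G J)
    hΛ O s X t U Y hU hUU t' P (fun q => totalSpin n (a q)) (fun q => totalSpin n (a' q)) Q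
    (fun q _ _ hv => totalSpin_mulVec_eq_zero_of_mem_groundSpace n G A J hG hA hJ hcard hv (a q))
    (fun q _ _ hv =>
      totalSpin_conjTranspose_mulVec_eq_zero_of_mem_groundSpace n G A J hG hA hJ hcard hv (a' q))
    hμ hE hcert

/-- **Energy certificate with singlet rows ⇒ certified LOWER bound on `E₀`** (Heisenberg
antiferromagnet on a connected bipartite balanced graph, `J > 0`):
`H − c·1 = Gram + Σ[H,X] + Σ(U Y Uᴴ − Y) + Σ_q (P_q S^{a q}_tot + S^{a' q}_tot Q_q)` ⇒ `c ≤ E₀(H)`.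
The relaxation with singlet rows bounds the SINGLET-SECTOR ground energy, which IS `E₀` by
Lieb–Mattis — this is what makes the rows sound for a certified lower bound (the window theorem
with `V = H`, `μ = 0`). [cite: LiebMattis1962, Theorem 2] [cite: KullEtAl2024, §5.3] -/
theorem groundEnergy_ge_of_certificate_singlet (hG : G.Connected)
    (hA : G.IsBipartiteWith (A : Set Λ) (↑A)ᶜ) (hJ : 0 < J) (hcard : Aᶜ.card = A.card)
    {Λm : Matrix m m ℂ} (hΛ : Λm.PosSemidef) (O : m → Op Λ (n + 1))
    {κ : Type*} (s : Finset κ) (X : κ → Op Λ (n + 1))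
    {ι : Type*} (t : Finset ι) (U Y : ι → Op Λ (n + 1))
    (hU : ∀ l ∈ t, U l * heisenbergHamiltonian n G J = heisenbergHamiltonian n G J * U l)
    (hUU : ∀ l ∈ t, (U l)ᴴ * U l = 1)
    {ι' : Type*} (t' : Finset ι') (P Q : ι' → Op Λ (n + 1)) (a a' : ι' → Fin 3) {c : ℝ}
    (hcert : heisenbergHamiltonian n G J - (c : ℂ) • (1 : Op Λ (n + 1)) =
      gramForm Λm O +
        (∑ k ∈ s, (heisenbergHamiltonian n G J * X k - X k * heisenbergHamiltonian n G J) +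
            ∑ l ∈ t, (U l * Y l * (U l)ᴴ - Y l) +
          ∑ q ∈ t', (P q * totalSpin n (a q) + totalSpin n (a' q) * Q q))) :
    c ≤ (heisenbergHamiltonian n G J).groundEnergy := by
  haveI : Nonempty (TensorIndex Λ (n + 1)) := ⟨fun _ => 0⟩
  have h := re_groundStateFunctional_ge_of_windowCertificate_singlet n G A J hG hA hJ hcard hΛ O s
    X t U Y hU hUU t' P Q a a' (μ := 0) le_rfl le_rfl
    (by rw [hcert, Complex.ofReal_zero, zero_smul, add_zero])
  rwa [Matrix.groundStateFunctional_hamiltonian (heisenbergHamiltonian_isHermitian n G J),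
    Complex.ofReal_re] at h

end Heisenberg


end

end Summit.HubbardSuperconductivity.HubbardLadder
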